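import Mathlib
import Summits.NavierStokesRegularity.NavierStokesRegularity.Theorems.BarrierStepRungThreeTargetOfCertificateThree
import HarnessLib

/-!
# The SOS-ready end of the repaired line: a window certificate WITH MARGIN in format K2″ closes rung TL-M3
  (route `BarrierStepRungThree`; glue supporting items stmt-NavierStokesRegularity-23648 / 23420)

In the typed line, `BarrierCertificate` (K1) was split into `WindowCertificateMargin` (undisturbed decrease
of margin `2γ` + operator-norm bound `‖fderiv v x‖ ≤ Λ` on `{v ≤ 0}` + absorption budget) →
`DisturbanceAbsorption` → `BarrierCertificate` (items 23648 / 23649 / 23650, the last two CLOSED). Prover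
ns-bsr3-p1 found the ∀-crux `BarrierSoundness` misstated as typed and proved the repaired ∀-side
`BarrierSoundness.barrierSoundness₃` (per-coordinate caps `Φ i j`, properness bounds `Mw i j`,
one-directional tail bookkeeping); `BarrierStepRungThreeTargetOfCertificateThree.lean` turned its hypotheses
(`Certificate″`) into the rung. This file is the same split ONE LEVEL UP, in the repaired format:

* `clm_add_le_of_opNorm_budget₂` — disturbance absorption with a PER-COORDINATE budget
  `Λ · b i j ≤ γ` (sup norm on `Fin 4 → Fin n → ℝ`; `map_add`, `le_opNorm`, `pi_norm_le_iff_of_nonneg`);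
* `certificate₃_of_windowCertificateMargin₃` — `WindowCertificateMargin″ → Certificate″`: the clauses of
  `barrierSoundness₃` with the ROBUST decrease replaced by the UNDISTURBED decrease
  `⟨∇v(win S), quadTerm(S)|window⟩ ≤ -2γ` on REGION″ ∩ {g > 0}, the bound `‖fderiv ℝ v x‖ ≤ Λ` on
  `{v ≤ 0}`, `0 ≤ Λ`, and the per-coordinate budget `Λ·η·4^(kLo+j)·√(Φ i j) ≤ γ` imply the robust clause
  for every defect `|d i j| ≤ η·4^(kLo+j)·√(Φ i j)`, all other clauses copied verbatim;
* `taoLadderRungThree_target_of_windowCertificateMargin₃` — hence `WindowCertificateMargin″ → Target`.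

So the repaired line's ONLY open obligation is `WindowCertificateMargin″` for SOME comparable table: for
polynomial `(v, g)` every clause is a polynomial (or norm) inequality in finitely many reals — one
Putinar / SDP feasibility instance per (table, window, degree), kernel-checkable after rational rounding.
This is the recommended re-typing of item 23648 (and, with `Certificate″`, of 23420).

HONEST FRAMING: finite-dimensional plumbing plus implications about Tao-type MODEL lattice pseudo-flows
(Tao 2016 §6); the certificate itself is NOT produced here (it is the line's open ∃-crux); the conclusion
is the class rung TL-M3 (`TaoLadderRungThree.Target`), not the summit Statement; nothing here is a
statement about the Navier–Stokes equations, and NS regularity is not proved by any of this.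
-/

noncomputable section

-- the sub-problem namespace `Summit.NavierStokesRegularity.NavierStokesRegularity` repeats the summit name by design (D-0017)
set_option linter.dupNamespace false

namespace Summit.NavierStokesRegularity.NavierStokesRegularity.Theorems

open Literature.Analysis.FluidPDE Literature.Analysis.FluidPDE.TaoCascade

/-- Disturbance absorption with a PER-COORDINATE budget: if a continuous linear functional `L` on
`Fin 4 → Fin n → ℝ` (sup norm) satisfies `L w ≤ -2γ`, `‖L‖ ≤ Λ` with `0 ≤ γ`, `0 ≤ Λ`, and the
perturbation `d` is entrywise bounded by numbers `b i j` with `Λ * b i j ≤ γ` for every `(i, j)`, then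
`L (w + d) ≤ -γ` (`map_add`, `ContinuousLinearMap.le_opNorm`, `pi_norm_le_iff_of_nonneg`). The variant of
`clm_add_le_of_opNorm_budget` (file `BarrierStepRungThreeDisturbanceAbsorption.lean`) with `b` indexed by
mode and shell. [cite: PrajnaRantzer2007, §3.4 p. 1009 (robust decrease under bounded disturbance)] -/
theorem clm_add_le_of_opNorm_budget₂ {n : ℕ} (L : (Fin 4 → Fin n → ℝ) →L[ℝ] ℝ)
    (γ Λ : ℝ) (b : Fin 4 → Fin n → ℝ) (w d : Fin 4 → Fin n → ℝ) (hγ : 0 ≤ γ) (hΛ : 0 ≤ Λ)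
    (hw : L w ≤ -(2 * γ)) (hL : ‖L‖ ≤ Λ) (hb : ∀ (i : Fin 4) (j : Fin n), Λ * b i j ≤ γ)
    (hd : ∀ (i : Fin 4) (j : Fin n), |d i j| ≤ b i j) : L (w + d) ≤ -γ := by
  have hLd : L d ≤ Λ * ‖d‖ := by
    calc L d ≤ |L d| := le_abs_self _
      _ = ‖L d‖ := (Real.norm_eq_abs _).symm
      _ ≤ ‖L‖ * ‖d‖ := L.le_opNorm d
      _ ≤ Λ * ‖d‖ := mul_le_mul_of_nonneg_right hL (norm_nonneg _)
  have habs : Λ * ‖d‖ ≤ γ := by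
    rcases eq_or_lt_of_le hΛ with hΛ0 | hΛpos
    · rw [← hΛ0, zero_mul]; exact hγ
    · have hdn : ‖d‖ ≤ γ / Λ := by
        refine (pi_norm_le_iff_of_nonneg (div_nonneg hγ hΛ)).2 fun i => ?_
        refine (pi_norm_le_iff_of_nonneg (div_nonneg hγ hΛ)).2 fun j => ?_
        rw [Real.norm_eq_abs]
        calc |d i j| ≤ b i j := hd i j
          _ ≤ γ / Λ := by rw [le_div_iff₀ hΛpos, mul_comm]; exact hb i j
      calc Λ * ‖d‖ ≤ Λ * (γ / Λ) := mul_le_mul_of_nonneg_left hdn hΛ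
        _ = γ := mul_div_cancel₀ γ hΛpos.ne'
  rw [map_add]
  linarith

/-- **`WindowCertificateMargin″ → Certificate″`** (the gen-1 split of the ∃-crux, repaired format). If SOME
data `(R, θ, c, η, γ, i₀, α, X₀, n, kLo, v, g, r, q, ρ, env, Ψ, Mw, Φ, win, vf, Λ)` satisfy the clauses of
`BarrierSoundness.barrierSoundness₃` with the robust decrease REPLACED by: the undisturbed decrease
`(fderiv ℝ v (win S)) (quadTerm(S)|window) ≤ -2γ` on REGION″ ∩ {g > 0}, the operator-norm bound
`‖fderiv ℝ v x‖ ≤ Λ` on `{v ≤ 0}`, `0 ≤ Λ`, and the per-coordinate absorption budget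
`Λ·η·2^(2(kLo+j))·√(Φ i j) ≤ γ` — then the same data (without `Λ`) satisfy the clauses of
`barrierSoundness₃` verbatim (`Certificate″`): every clause is copied, and the robust decrease
`(fderiv ℝ v (win S)) (quadTerm(S)|window + d) ≤ -γ` for `|d i j| ≤ η·2^(2(kLo+j))·√(Φ i j)` is
`clm_add_le_of_opNorm_budget₂` at `L = fderiv ℝ v (win S)` (the bound `‖L‖ ≤ Λ` is available because
`v (win S) ≤ 0` on the region). [cite: PrajnaRantzer2007, Thm 3.5 and §3.4 p. 1009] -/
theorem certificate₃_of_windowCertificateMargin₃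
    (hW : ∃ (R θ c η γ : ℝ) (i₀ : Fin 4) (α : Fin 4 → Fin 4 → Fin 4 → ℤ × ℤ × ℤ → ℝ) (X₀ : Fin 4 → ℝ) (n : ℕ) (kLo : ℤ) (v g : (Fin 4 → Fin n → ℝ) → ℝ) (r q ρ env Ψ : ℤ → ℝ) (Mw Φ : Fin 4 → Fin n → ℝ) (win : (Fin 4 → ℤ → ℝ) → (Fin 4 → Fin n → ℝ)) (vf : (Fin 4 → ℤ → ℝ) → (Fin 4 → ℤ → ℝ)) (Λ : ℝ), 1 ≤ R ∧ Literature.Analysis.FluidPDE.TaoCascade.InTableClass R α ∧ X₀ i₀ ≠ 0 ∧ 0 ≤ θ ∧ θ ≤ 1 / 2 ∧ 0 < c ∧ 0 < η ∧ 0 < γ ∧ kLo ≤ 0 ∧ (2 : ℤ) ≤ kLo + n ∧ (∀ (S : Fin 4 → ℤ → ℝ) (i : Fin 4) (j : Fin n), win S i j = S i (kLo + (j : ℕ))) ∧ (∀ (S : Fin 4 → ℤ → ℝ) (i : Fin 4) (k : ℤ), vf S i k = Literature.Analysis.FluidPDE.TaoCascade.quadTerm 1 α (fun i' k' (_ : ℝ)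 => S i' k') i k 0) ∧ ContDiff ℝ 1 v ∧ Continuous g ∧ (∀ (L' : ℕ) (k : ℤ), Literature.Analysis.FluidPDE.TaoCascade.slackWeight 1 θ c env L' k ≤ Ψ k) ∧ (∀ k : ℤ, 0 ≤ r k ∧ r k < q k ∧ 0 ≤ ρ k ∧ r k + c * ρ k ≤ q k ∧ q k ^ 2 / 2 ≤ env k) ∧ (∀ k : ℤ, kLo + n ≤ k → (1 + 1 : ℝ) ^ ((5 : ℝ) * ((k - 1 : ℤ) : ℝ) / 2) * (∑ i₁ : Fin 4, ∑ i₂ : Fin 4, ∑ i₃ : Fin 4, |α i₁ i₂ i₃ (0, 0, 1)|) * q (k - 1) ^ 2 ≤ ρ k) ∧ (∀ (i : Fin 4) (j : Fin n), (j : ℕ) + 1 = n → 2 * Φ i j ≤ q (kLo + (j : ℕ)) ^ 2) ∧ (∀ k : ℤ, kLo + n ≤ k → q (k + 1) ≤ (1 + 1 : ℝ) ^ (-θ) * r k) ∧ (∀ (i : Fin 4) (j : Fin n), 0 ≤ Φ i j ∧ Φ i j ≤ env (kLo + (j : ℕ)) ∧ Mw i j ^ 2 / 2 + η * Ψ (kLo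 + (j : ℕ)) + η * (1 + 1 : ℝ) ^ ((2 : ℝ) * ((kLo + (j : ℕ) : ℤ) : ℝ)) * c * Φ i j < Φ i j) ∧ (∃ M₁ : ℝ, ∀ k : ℤ, kLo + n ≤ k → (1 + (1 + 1 : ℝ) ^ ((10 : ℝ) * (k : ℝ))) * q k ≤ M₁) ∧ v (win (Literature.Analysis.FluidPDE.TaoCascade.datumState i₀ X₀)) ≤ 0 ∧ 0 < g (win (Literature.Analysis.FluidPDE.TaoCascade.datumState i₀ X₀)) ∧ (∀ x : Fin 4 → Fin n → ℝ, v x ≤ 0 → ∀ i j, |x i j| ≤ Mw i j) ∧ (∀ x : Fin 4 → Fin n → ℝ, v x ≤ 0 → 0 < g x → -(γ * c) < v x) ∧ (∀ (S F : Fin 4 → ℤ → ℝ), (v (win S) ≤ 0 ∧ (∀ i k, S i k ^ 2 ≤ 2 * F i k) ∧ (∀ i k, 0 ≤ F i k) ∧ (∀ i k, (k < kLo ∨ kLo + n ≤ k) → F i k ≤ q k ^ 2 / 2) ∧ (∀ (i : Fin 4) (j : Fin n), F i (kLo + (j : ℕ)) ≤ Φ i j)) → 0 < g (win S) → (fderiv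 ℝ v (win S)) (fun i j => vf S i (kLo + (j : ℕ))) ≤ -(2 * γ)) ∧ (∀ x : Fin 4 → Fin n → ℝ, v x ≤ 0 → ‖fderiv ℝ v x‖ ≤ Λ) ∧ 0 ≤ Λ ∧ (∀ (i : Fin 4) (j : Fin n), Λ * (η * (1 + 1 : ℝ) ^ ((2 : ℝ) * ((kLo + (j : ℕ) : ℤ) : ℝ)) * Real.sqrt (Φ i j)) ≤ γ) ∧ (∀ (S F : Fin 4 → ℤ → ℝ), (v (win S) ≤ 0 ∧ (∀ i k, S i k ^ 2 ≤ 2 * F i k) ∧ (∀ i k, 0 ≤ F i k) ∧ (∀ i k, (k < kLo ∨ kLo + n ≤ k) → F i k ≤ q k ^ 2 / 2) ∧ (∀ (i : Fin 4) (j : Fin n), F i (kLo + (j : ℕ)) ≤ Φ i j)) → ∀ (i : Fin 4) (k : ℤ), k < kLo → vf S i k * S i k ≤ ρ k * |S i k|) ∧ (∀ (S F : Fin 4 → ℤ → ℝ), (v (win S) ≤ 0 ∧ (∀ i k, S i k ^ 2 ≤ 2 * F i k) ∧ (∀ i k, 0 ≤ F i k) ∧ (∀ i k, (k < kLo ∨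 kLo + n ≤ k) → F i k ≤ q k ^ 2 / 2) ∧ (∀ (i : Fin 4) (j : Fin n), F i (kLo + (j : ℕ)) ≤ Φ i j)) → g (win S) ≤ 0 → (1 + 1 : ℝ) ^ (-θ) ≤ |S i₀ 1| ∧ v (win (fun i k => S i (1 + k) / |S i₀ 1|)) ≤ 0 ∧ 0 < g (win (fun i k => S i (1 + k) / |S i₀ 1|)) ∧ (∀ i k, k < kLo → F i (1 + k) / |S i₀ 1| ^ 2 ≤ r k ^ 2 / 2))) :
    ∃ (R θ c η γ : ℝ) (i₀ : Fin 4) (α : Fin 4 → Fin 4 → Fin 4 → ℤ × ℤ × ℤ → ℝ) (X₀ : Fin 4 → ℝ) (n : ℕ) (kLo : ℤ) (v g : (Fin 4 → Fin n → ℝ) → ℝ) (r q ρ env Ψ : ℤ → ℝ) (Mw Φ : Fin 4 → Fin n → ℝ) (win : (Fin 4 → ℤ → ℝ) → (Fin 4 → Fin n → ℝ)) (vf : (Fin 4 → ℤ → ℝ) → (Fin 4 → ℤ → ℝ)), 1 ≤ R ∧ Literature.Analysis.FluidPDE.TaoCascade.InTableClass R α ∧ X₀ i₀ ≠ 0 ∧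 0 ≤ θ ∧ θ ≤ 1 / 2 ∧ 0 < c ∧ 0 < η ∧ 0 < γ ∧ kLo ≤ 0 ∧ (2 : ℤ) ≤ kLo + n ∧ (∀ (S : Fin 4 → ℤ → ℝ) (i : Fin 4) (j : Fin n), win S i j = S i (kLo + (j : ℕ))) ∧ (∀ (S : Fin 4 → ℤ → ℝ) (i : Fin 4) (k : ℤ), vf S i k = Literature.Analysis.FluidPDE.TaoCascade.quadTerm 1 α (fun i' k' (_ : ℝ) => S i' k') i k 0) ∧ ContDiff ℝ 1 v ∧ Continuous g ∧ (∀ (L' : ℕ) (k : ℤ), Literature.Analysis.FluidPDE.TaoCascade.slackWeight 1 θ c env L' k ≤ Ψ k) ∧ (∀ k : ℤ, 0 ≤ r k ∧ r k < q k ∧ 0 ≤ ρ k ∧ r k + c * ρ k ≤ q k ∧ q k ^ 2 / 2 ≤ env k) ∧ (∀ k : ℤ, kLo + n ≤ k → (1 + 1 : ℝ) ^ ((5 : ℝ) * ((k - 1 : ℤ) : ℝ) / 2) * (∑ i₁ : Fin 4, ∑ i₂ : Fin 4, ∑ i₃ : Fin 4, |α i₁ i₂ i₃ (0, 0, 1)|)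 * q (k - 1) ^ 2 ≤ ρ k) ∧ (∀ (i : Fin 4) (j : Fin n), (j : ℕ) + 1 = n → 2 * Φ i j ≤ q (kLo + (j : ℕ)) ^ 2) ∧ (∀ k : ℤ, kLo + n ≤ k → q (k + 1) ≤ (1 + 1 : ℝ) ^ (-θ) * r k) ∧ (∀ (i : Fin 4) (j : Fin n), 0 ≤ Φ i j ∧ Φ i j ≤ env (kLo + (j : ℕ)) ∧ Mw i j ^ 2 / 2 + η * Ψ (kLo + (j : ℕ)) + η * (1 + 1 : ℝ) ^ ((2 : ℝ) * ((kLo + (j : ℕ) : ℤ) : ℝ)) * c * Φ i j < Φ i j) ∧ (∃ M₁ : ℝ, ∀ k : ℤ, kLo + n ≤ k → (1 + (1 + 1 : ℝ) ^ ((10 : ℝ) * (k : ℝ))) * q k ≤ M₁) ∧ v (win (Literature.Analysis.FluidPDE.TaoCascade.datumState i₀ X₀)) ≤ 0 ∧ 0 < g (win (Literature.Analysis.FluidPDE.TaoCascade.datumState i₀ X₀)) ∧ (∀ x : Fin 4 → Fin n → ℝ, v x ≤ 0 → ∀ i j, |x i j| ≤ Mw i j) ∧ (∀ x : Fin 4 →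 Fin n → ℝ, v x ≤ 0 → 0 < g x → -(γ * c) < v x) ∧ (∀ (S F : Fin 4 → ℤ → ℝ) (d : Fin 4 → Fin n → ℝ), (v (win S) ≤ 0 ∧ (∀ i k, S i k ^ 2 ≤ 2 * F i k) ∧ (∀ i k, 0 ≤ F i k) ∧ (∀ i k, (k < kLo ∨ kLo + n ≤ k) → F i k ≤ q k ^ 2 / 2) ∧ (∀ (i : Fin 4) (j : Fin n), F i (kLo + (j : ℕ)) ≤ Φ i j)) → 0 < g (win S) → (∀ (i : Fin 4) (j : Fin n), |d i j| ≤ η * (1 + 1 : ℝ) ^ ((2 : ℝ) * ((kLo + (j : ℕ) : ℤ) : ℝ)) * Real.sqrt (Φ i j)) → (fderiv ℝ v (win S)) (fun i j => vf S i (kLo + (j : ℕ)) + d i j) ≤ -γ) ∧ (∀ (S F : Fin 4 → ℤ → ℝ), (v (win S) ≤ 0 ∧ (∀ i k, S i k ^ 2 ≤ 2 * F i k) ∧ (∀ i k, 0 ≤ F i k) ∧ (∀ i k, (k < kLo ∨ kLo + n ≤ k) → F i k ≤ q k ^ 2 / 2) ∧ (∀ (i : Fin 4) (j : Fin n), F i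 (kLo + (j : ℕ)) ≤ Φ i j)) → ∀ (i : Fin 4) (k : ℤ), k < kLo → vf S i k * S i k ≤ ρ k * |S i k|) ∧ (∀ (S F : Fin 4 → ℤ → ℝ), (v (win S) ≤ 0 ∧ (∀ i k, S i k ^ 2 ≤ 2 * F i k) ∧ (∀ i k, 0 ≤ F i k) ∧ (∀ i k, (k < kLo ∨ kLo + n ≤ k) → F i k ≤ q k ^ 2 / 2) ∧ (∀ (i : Fin 4) (j : Fin n), F i (kLo + (j : ℕ)) ≤ Φ i j)) → g (win S) ≤ 0 → (1 + 1 : ℝ) ^ (-θ) ≤ |S i₀ 1| ∧ v (win (fun i k => S i (1 + k) / |S i₀ 1|)) ≤ 0 ∧ 0 < g (win (fun i k => S i (1 + k) / |S i₀ 1|)) ∧ (∀ i k, k < kLo → F i (1 + k) / |S i₀ 1| ^ 2 ≤ r k ^ 2 / 2)) := by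
  obtain ⟨R, θ, c, η, γ, i₀, α, X₀, n, kLo, v, g, r, q, ρ, env, Ψ, Mw, Φ, win, vf, Λ, hR, hα, hX₀, hθ0,
    hθ, hc, hη, hγ, hkLo, hkn, hwin, hvf, hv, hg, hΨ, hprof, hup, hΦq, hdecay, hΦ, hM₁, hv0, hg0,
    hproper, hfloor, hdec, hΛ, hΛ0, hbudget, htail, hgoal⟩ := hW
  refine ⟨R, θ, c, η, γ, i₀, α, X₀, n, kLo, v, g, r, q, ρ, env, Ψ, Mw, Φ, win, vf, hR, hα, hX₀, hθ0,
    hθ, hc, hη, hγ, hkLo, hkn, hwin, hvf, hv, hg, hΨ, hprof, hup, hΦq, hdecay, hΦ, hM₁, hv0, hg0,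
    hproper, hfloor, ?_, htail, hgoal⟩
  intro S F d hreg hgS hd
  have h2 : (fderiv ℝ v (win S)) (fun i j => vf S i (kLo + (j : ℕ))) ≤ -(2 * γ) := hdec S F hreg hgS
  have habs := clm_add_le_of_opNorm_budget₂ (fderiv ℝ v (win S)) γ Λ
    (fun i j => η * (1 + 1 : ℝ) ^ ((2 : ℝ) * ((kLo + (j : ℕ) : ℤ) : ℝ)) * Real.sqrt (Φ i j))
    (fun i j => vf S i (kLo + (j : ℕ))) d hγ.le hΛ0 h2 (hΛ _ hreg.1) hbudget hd
  have heq : (fun (i : Fin 4) (j : Fin n) => vf S i (kLo + (j : ℕ)) + d i j) =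
      (fun (i : Fin 4) (j : Fin n) => vf S i (kLo + (j : ℕ))) + d := by
    funext i j
    rfl
  rw [heq]
  exact habs

/-- **Rung TL-M3 from a window certificate WITH MARGIN in the repaired format K2″**
(`WindowCertificateMargin″ → Target`): compose `certificate₃_of_windowCertificateMargin₃` with
`taoLadderRungThree_target_of_certificate₃`. In this format the line's only open obligation is the
certificate with margin for SOME comparable table — for polynomial `(v, g)` a finite list of polynomial /
norm inequalities in finitely many real variables (one Putinar/SDP instance per table, window, degree).
[cite: Tao2016AveragedNS, §6.4 Prop. 6.5 with §6.1–6.2; PrajnaRantzer2007 Thm 3.5 and §3.4] -/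
theorem taoLadderRungThree_target_of_windowCertificateMargin₃
    (hW : ∃ (R θ c η γ : ℝ) (i₀ : Fin 4) (α : Fin 4 → Fin 4 → Fin 4 → ℤ × ℤ × ℤ → ℝ) (X₀ : Fin 4 → ℝ) (n : ℕ) (kLo : ℤ) (v g : (Fin 4 → Fin n → ℝ) → ℝ) (r q ρ env Ψ : ℤ → ℝ) (Mw Φ : Fin 4 → Fin n → ℝ) (win : (Fin 4 → ℤ → ℝ) → (Fin 4 → Fin n → ℝ)) (vf : (Fin 4 → ℤ → ℝ) → (Fin 4 → ℤ → ℝ)) (Λ : ℝ), 1 ≤ R ∧ Literature.Analysis.FluidPDE.TaoCascade.InTableClass R α ∧ X₀ i₀ ≠ 0 ∧ 0 ≤ θ ∧ θ ≤ 1 / 2 ∧ 0 < c ∧ 0 < η ∧ 0 < γ ∧ kLo ≤ 0 ∧ (2 : ℤ) ≤ kLo + n ∧ (∀ (S : Fin 4 → ℤ → ℝ) (i : Fin 4) (j : Fin n), win S i j = S i (kLo + (j : ℕ))) ∧ (∀ (S : Fin 4 → ℤ → ℝ) (i : Fin 4) (k : ℤ), vf S i k = Literature.Analysis.FluidPDE.TaoCascade.quadTerm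 1 α (fun i' k' (_ : ℝ) => S i' k') i k 0) ∧ ContDiff ℝ 1 v ∧ Continuous g ∧ (∀ (L' : ℕ) (k : ℤ), Literature.Analysis.FluidPDE.TaoCascade.slackWeight 1 θ c env L' k ≤ Ψ k) ∧ (∀ k : ℤ, 0 ≤ r k ∧ r k < q k ∧ 0 ≤ ρ k ∧ r k + c * ρ k ≤ q k ∧ q k ^ 2 / 2 ≤ env k) ∧ (∀ k : ℤ, kLo + n ≤ k → (1 + 1 : ℝ) ^ ((5 : ℝ) * ((k - 1 : ℤ) : ℝ) / 2) * (∑ i₁ : Fin 4, ∑ i₂ : Fin 4, ∑ i₃ : Fin 4, |α i₁ i₂ i₃ (0, 0, 1)|) * q (k - 1) ^ 2 ≤ ρ k) ∧ (∀ (i : Fin 4) (j : Fin n), (j : ℕ) + 1 = n → 2 * Φ i j ≤ q (kLo + (j : ℕ)) ^ 2) ∧ (∀ k : ℤ, kLo + n ≤ k → q (k + 1) ≤ (1 + 1 : ℝ) ^ (-θ) * r k) ∧ (∀ (i : Fin 4) (j : Fin n), 0 ≤ Φ i j ∧ Φ i j ≤ env (kLo + (j : ℕ)) ∧ Mw i j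 ^ 2 / 2 + η * Ψ (kLo + (j : ℕ)) + η * (1 + 1 : ℝ) ^ ((2 : ℝ) * ((kLo + (j : ℕ) : ℤ) : ℝ)) * c * Φ i j < Φ i j) ∧ (∃ M₁ : ℝ, ∀ k : ℤ, kLo + n ≤ k → (1 + (1 + 1 : ℝ) ^ ((10 : ℝ) * (k : ℝ))) * q k ≤ M₁) ∧ v (win (Literature.Analysis.FluidPDE.TaoCascade.datumState i₀ X₀)) ≤ 0 ∧ 0 < g (win (Literature.Analysis.FluidPDE.TaoCascade.datumState i₀ X₀)) ∧ (∀ x : Fin 4 → Fin n → ℝ, v x ≤ 0 → ∀ i j, |x i j| ≤ Mw i j) ∧ (∀ x : Fin 4 → Fin n → ℝ, v x ≤ 0 → 0 < g x → -(γ * c) < v x) ∧ (∀ (S F : Fin 4 → ℤ → ℝ), (v (win S) ≤ 0 ∧ (∀ i k, S i k ^ 2 ≤ 2 * F i k) ∧ (∀ i k, 0 ≤ F i k) ∧ (∀ i k, (k < kLo ∨ kLo + n ≤ k) → F i k ≤ q k ^ 2 / 2) ∧ (∀ (i : Fin 4) (j : Fin n), F i (kLo + (j : ℕ)) ≤ Φ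 i j)) → 0 < g (win S) → (fderiv ℝ v (win S)) (fun i j => vf S i (kLo + (j : ℕ))) ≤ -(2 * γ)) ∧ (∀ x : Fin 4 → Fin n → ℝ, v x ≤ 0 → ‖fderiv ℝ v x‖ ≤ Λ) ∧ 0 ≤ Λ ∧ (∀ (i : Fin 4) (j : Fin n), Λ * (η * (1 + 1 : ℝ) ^ ((2 : ℝ) * ((kLo + (j : ℕ) : ℤ) : ℝ)) * Real.sqrt (Φ i j)) ≤ γ) ∧ (∀ (S F : Fin 4 → ℤ → ℝ), (v (win S) ≤ 0 ∧ (∀ i k, S i k ^ 2 ≤ 2 * F i k) ∧ (∀ i k, 0 ≤ F i k) ∧ (∀ i k, (k < kLo ∨ kLo + n ≤ k) → F i k ≤ q k ^ 2 / 2) ∧ (∀ (i : Fin 4) (j : Fin n), F i (kLo + (j : ℕ)) ≤ Φ i j)) → ∀ (i : Fin 4) (k : ℤ), k < kLo → vf S i k * S i k ≤ ρ k * |S i k|) ∧ (∀ (S F : Fin 4 → ℤ → ℝ), (v (win S) ≤ 0 ∧ (∀ i k, S i k ^ 2 ≤ 2 * F i k) ∧ (∀ i k, 0 ≤ F i k)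 ∧ (∀ i k, (k < kLo ∨ kLo + n ≤ k) → F i k ≤ q k ^ 2 / 2) ∧ (∀ (i : Fin 4) (j : Fin n), F i (kLo + (j : ℕ)) ≤ Φ i j)) → g (win S) ≤ 0 → (1 + 1 : ℝ) ^ (-θ) ≤ |S i₀ 1| ∧ v (win (fun i k => S i (1 + k) / |S i₀ 1|)) ≤ 0 ∧ 0 < g (win (fun i k => S i (1 + k) / |S i₀ 1|)) ∧ (∀ i k, k < kLo → F i (1 + k) / |S i₀ 1| ^ 2 ≤ r k ^ 2 / 2))) :
    Summit.NavierStokesRegularity.NavierStokesRegularity.Theses.TaoLadderRungThree.Target :=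
  taoLadderRungThree_target_of_certificate₃ (certificate₃_of_windowCertificateMargin₃ hW)

/-! ### Free split of the rate between the undisturbed decrease and the absorption budget

The margin `2γ` / budget `γ` split above is one choice; the clock-floor clause `v > -γ c` then forces
`c ≥ 2·(time to goal)` along any true orbit (prover ns-bsr3-p3's tail-rate squeeze, HOME STATUS
2026-08-28T00:53Z). The variants below take an ARBITRARY split: undisturbed decrease `≤ -(γ + δ)` and
budget `Λ·η·4^(kLo+j)·√(Φ i j) ≤ δ`, so that `c ≥ (1 + δ/γ)·(time to goal)` with `δ` as small as the
defect size `η` allows. -/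

/-- Disturbance absorption with a FREE split: if `L w ≤ -(γ + δ)`, `‖L‖ ≤ Λ` (`0 ≤ Λ`, `0 ≤ δ`) and the
perturbation `d` is entrywise bounded by `b i j` with `Λ * b i j ≤ δ`, then `L (w + d) ≤ -γ` (sup norm on
`Fin 4 → Fin n → ℝ`; `map_add`, `le_opNorm`, `pi_norm_le_iff_of_nonneg`).
[cite: PrajnaRantzer2007, §3.4 p. 1009 (robust decrease under bounded disturbance)] -/
theorem clm_add_le_of_opNorm_split {n : ℕ} (L : (Fin 4 → Fin n → ℝ) →L[ℝ] ℝ)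
    (γ δ Λ : ℝ) (b : Fin 4 → Fin n → ℝ) (w d : Fin 4 → Fin n → ℝ) (hδ : 0 ≤ δ) (hΛ : 0 ≤ Λ)
    (hw : L w ≤ -(γ + δ)) (hL : ‖L‖ ≤ Λ) (hb : ∀ (i : Fin 4) (j : Fin n), Λ * b i j ≤ δ)
    (hd : ∀ (i : Fin 4) (j : Fin n), |d i j| ≤ b i j) : L (w + d) ≤ -γ := by
  have hLd : L d ≤ Λ * ‖d‖ := by
    calc L d ≤ |L d| := le_abs_self _
      _ = ‖L d‖ := (Real.norm_eq_abs _).symm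
      _ ≤ ‖L‖ * ‖d‖ := L.le_opNorm d
      _ ≤ Λ * ‖d‖ := mul_le_mul_of_nonneg_right hL (norm_nonneg _)
  have habs : Λ * ‖d‖ ≤ δ := by
    rcases eq_or_lt_of_le hΛ with hΛ0 | hΛpos
    · rw [← hΛ0, zero_mul]; exact hδ
    · have hdn : ‖d‖ ≤ δ / Λ := by
        refine (pi_norm_le_iff_of_nonneg (div_nonneg hδ hΛ)).2 fun i => ?_
        refine (pi_norm_le_iff_of_nonneg (div_nonneg hδ hΛ)).2 fun j => ?_
        rw [Real.norm_eq_abs]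
        calc |d i j| ≤ b i j := hd i j
          _ ≤ δ / Λ := by rw [le_div_iff₀ hΛpos, mul_comm]; exact hb i j
      calc Λ * ‖d‖ ≤ Λ * (δ / Λ) := mul_le_mul_of_nonneg_left hdn hΛ
        _ = δ := mul_div_cancel₀ δ hΛpos.ne'
  rw [map_add]
  linarith

/-- **`WindowCertificateMarginSplit″ → Certificate″`** (free split `γ + δ` / `δ`). As
`certificate₃_of_windowCertificateMargin₃`, with the undisturbed decrease `≤ -(γ + δ)` on
REGION″ ∩ {g > 0} and the per-coordinate budget `Λ·η·2^(2(kLo+j))·√(Φ i j) ≤ δ` for an additional datum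
`δ` (necessarily `≥ 0`, by the budget at the bottom window shell); conclusion: the clauses of
`BarrierSoundness.barrierSoundness₃` verbatim, the robust decrease `≤ -γ` coming from
`clm_add_le_of_opNorm_split`. [cite: PrajnaRantzer2007, Thm 3.5 and §3.4 p. 1009] -/
theorem certificate₃_of_windowCertificateMarginSplit₃
    (hW : ∃ (R θ c η γ : ℝ) (i₀ : Fin 4) (α : Fin 4 → Fin 4 → Fin 4 → ℤ × ℤ × ℤ → ℝ) (X₀ : Fin 4 → ℝ) (n : ℕ) (kLo : ℤ) (v g : (Fin 4 → Fin n → ℝ) → ℝ) (r q ρ env Ψ : ℤ → ℝ) (Mw Φ : Fin 4 → Fin n → ℝ) (win : (Fin 4 → ℤ → ℝ) → (Fin 4 → Fin n → ℝ)) (vf : (Fin 4 → ℤ → ℝ) → (Fin 4 → ℤ → ℝ)) (Λ δ : ℝ), 1 ≤ R ∧ Literature.Analysis.FluidPDE.TaoCascade.InTableClass R α ∧ X₀ i₀ ≠ 0 ∧ 0 ≤ θ ∧ θ ≤ 1 / 2 ∧ 0 < c ∧ 0 < η ∧ 0 < γ ∧ kLo ≤ 0 ∧ (2 : ℤ) ≤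 kLo + n ∧ (∀ (S : Fin 4 → ℤ → ℝ) (i : Fin 4) (j : Fin n), win S i j = S i (kLo + (j : ℕ))) ∧ (∀ (S : Fin 4 → ℤ → ℝ) (i : Fin 4) (k : ℤ), vf S i k = Literature.Analysis.FluidPDE.TaoCascade.quadTerm 1 α (fun i' k' (_ : ℝ) => S i' k') i k 0) ∧ ContDiff ℝ 1 v ∧ Continuous g ∧ (∀ (L' : ℕ) (k : ℤ), Literature.Analysis.FluidPDE.TaoCascade.slackWeight 1 θ c env L' k ≤ Ψ k) ∧ (∀ k : ℤ, 0 ≤ r k ∧ r k < q k ∧ 0 ≤ ρ k ∧ r k + c * ρ k ≤ q k ∧ q k ^ 2 / 2 ≤ env k) ∧ (∀ k : ℤ, kLo + n ≤ k → (1 + 1 : ℝ) ^ ((5 : ℝ) * ((k - 1 : ℤ) : ℝ) / 2) * (∑ i₁ : Fin 4, ∑ i₂ : Fin 4, ∑ i₃ : Fin 4, |α i₁ i₂ i₃ (0, 0, 1)|) * q (k - 1) ^ 2 ≤ ρ k) ∧ (∀ (i : Fin 4) (j : Fin n), (j : ℕ) + 1 = n → 2 * Φ i j ≤ q (kLo +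 (j : ℕ)) ^ 2) ∧ (∀ k : ℤ, kLo + n ≤ k → q (k + 1) ≤ (1 + 1 : ℝ) ^ (-θ) * r k) ∧ (∀ (i : Fin 4) (j : Fin n), 0 ≤ Φ i j ∧ Φ i j ≤ env (kLo + (j : ℕ)) ∧ Mw i j ^ 2 / 2 + η * Ψ (kLo + (j : ℕ)) + η * (1 + 1 : ℝ) ^ ((2 : ℝ) * ((kLo + (j : ℕ) : ℤ) : ℝ)) * c * Φ i j < Φ i j) ∧ (∃ M₁ : ℝ, ∀ k : ℤ, kLo + n ≤ k → (1 + (1 + 1 : ℝ) ^ ((10 : ℝ) * (k : ℝ))) * q k ≤ M₁) ∧ v (win (Literature.Analysis.FluidPDE.TaoCascade.datumState i₀ X₀)) ≤ 0 ∧ 0 < g (win (Literature.Analysis.FluidPDE.TaoCascade.datumState i₀ X₀)) ∧ (∀ x : Fin 4 → Fin n → ℝ, v x ≤ 0 → ∀ i j, |x i j| ≤ Mw i j) ∧ (∀ x : Fin 4 → Fin n → ℝ, v x ≤ 0 → 0 < g x → -(γ * c) < v x) ∧ (∀ (S F : Fin 4 → ℤ → ℝ), (v (win S) ≤ 0 ∧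 (∀ i k, S i k ^ 2 ≤ 2 * F i k) ∧ (∀ i k, 0 ≤ F i k) ∧ (∀ i k, (k < kLo ∨ kLo + n ≤ k) → F i k ≤ q k ^ 2 / 2) ∧ (∀ (i : Fin 4) (j : Fin n), F i (kLo + (j : ℕ)) ≤ Φ i j)) → 0 < g (win S) → (fderiv ℝ v (win S)) (fun i j => vf S i (kLo + (j : ℕ))) ≤ -(γ + δ)) ∧ (∀ x : Fin 4 → Fin n → ℝ, v x ≤ 0 → ‖fderiv ℝ v x‖ ≤ Λ) ∧ 0 ≤ Λ ∧ (∀ (i : Fin 4) (j : Fin n), Λ * (η * (1 + 1 : ℝ) ^ ((2 : ℝ) * ((kLo + (j : ℕ) : ℤ) : ℝ)) * Real.sqrt (Φ i j)) ≤ δ) ∧ (∀ (S F : Fin 4 → ℤ → ℝ), (v (win S) ≤ 0 ∧ (∀ i k, S i k ^ 2 ≤ 2 * F i k) ∧ (∀ i k, 0 ≤ F i k) ∧ (∀ i k, (k < kLo ∨ kLo + n ≤ k) → F i k ≤ q k ^ 2 / 2) ∧ (∀ (i : Fin 4) (j : Fin n), F i (kLo + (j : ℕ)) ≤ Φ i j))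 → ∀ (i : Fin 4) (k : ℤ), k < kLo → vf S i k * S i k ≤ ρ k * |S i k|) ∧ (∀ (S F : Fin 4 → ℤ → ℝ), (v (win S) ≤ 0 ∧ (∀ i k, S i k ^ 2 ≤ 2 * F i k) ∧ (∀ i k, 0 ≤ F i k) ∧ (∀ i k, (k < kLo ∨ kLo + n ≤ k) → F i k ≤ q k ^ 2 / 2) ∧ (∀ (i : Fin 4) (j : Fin n), F i (kLo + (j : ℕ)) ≤ Φ i j)) → g (win S) ≤ 0 → (1 + 1 : ℝ) ^ (-θ) ≤ |S i₀ 1| ∧ v (win (fun i k => S i (1 + k) / |S i₀ 1|)) ≤ 0 ∧ 0 < g (win (fun i k => S i (1 + k) / |S i₀ 1|)) ∧ (∀ i k, k < kLo → F i (1 + k) / |S i₀ 1| ^ 2 ≤ r k ^ 2 / 2))) :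
    ∃ (R θ c η γ : ℝ) (i₀ : Fin 4) (α : Fin 4 → Fin 4 → Fin 4 → ℤ × ℤ × ℤ → ℝ) (X₀ : Fin 4 → ℝ) (n : ℕ) (kLo : ℤ) (v g : (Fin 4 → Fin n → ℝ) → ℝ) (r q ρ env Ψ : ℤ → ℝ) (Mw Φ : Fin 4 → Fin n → ℝ) (win : (Fin 4 → ℤ → ℝ) → (Fin 4 → Fin n → ℝ)) (vf : (Fin 4 → ℤ → ℝ) → (Fin 4 → ℤ → ℝ)), 1 ≤ R ∧ Literature.Analysis.FluidPDE.TaoCascade.InTableClass R α ∧ X₀ i₀ ≠ 0 ∧ 0 ≤ θ ∧ θ ≤ 1 / 2 ∧ 0 < c ∧ 0 < η ∧ 0 < γ ∧ kLo ≤ 0 ∧ (2 : ℤ) ≤ kLo + n ∧ (∀ (S : Fin 4 → ℤ → ℝ) (i : Fin 4) (j : Fin n), win S i j = S i (kLo + (j : ℕ))) ∧ (∀ (S : Fin 4 → ℤ → ℝ) (i : Fin 4) (k : ℤ), vf S i k = Literature.Analysis.FluidPDE.TaoCascade.quadTerm 1 α (fun i' k' (_ : ℝ) => S i' k') i k 0)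 ∧ ContDiff ℝ 1 v ∧ Continuous g ∧ (∀ (L' : ℕ) (k : ℤ), Literature.Analysis.FluidPDE.TaoCascade.slackWeight 1 θ c env L' k ≤ Ψ k) ∧ (∀ k : ℤ, 0 ≤ r k ∧ r k < q k ∧ 0 ≤ ρ k ∧ r k + c * ρ k ≤ q k ∧ q k ^ 2 / 2 ≤ env k) ∧ (∀ k : ℤ, kLo + n ≤ k → (1 + 1 : ℝ) ^ ((5 : ℝ) * ((k - 1 : ℤ) : ℝ) / 2) * (∑ i₁ : Fin 4, ∑ i₂ : Fin 4, ∑ i₃ : Fin 4, |α i₁ i₂ i₃ (0, 0, 1)|) * q (k - 1) ^ 2 ≤ ρ k) ∧ (∀ (i : Fin 4) (j : Fin n), (j : ℕ) + 1 = n → 2 * Φ i j ≤ q (kLo + (j : ℕ)) ^ 2) ∧ (∀ k : ℤ, kLo + n ≤ k → q (k + 1) ≤ (1 + 1 : ℝ) ^ (-θ) * r k) ∧ (∀ (i : Fin 4) (j : Fin n), 0 ≤ Φ i j ∧ Φ i j ≤ env (kLo + (j : ℕ)) ∧ Mw i j ^ 2 / 2 + η * Ψ (kLo + (j : ℕ))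 + η * (1 + 1 : ℝ) ^ ((2 : ℝ) * ((kLo + (j : ℕ) : ℤ) : ℝ)) * c * Φ i j < Φ i j) ∧ (∃ M₁ : ℝ, ∀ k : ℤ, kLo + n ≤ k → (1 + (1 + 1 : ℝ) ^ ((10 : ℝ) * (k : ℝ))) * q k ≤ M₁) ∧ v (win (Literature.Analysis.FluidPDE.TaoCascade.datumState i₀ X₀)) ≤ 0 ∧ 0 < g (win (Literature.Analysis.FluidPDE.TaoCascade.datumState i₀ X₀)) ∧ (∀ x : Fin 4 → Fin n → ℝ, v x ≤ 0 → ∀ i j, |x i j| ≤ Mw i j) ∧ (∀ x : Fin 4 → Fin n → ℝ, v x ≤ 0 → 0 < g x → -(γ * c) < v x) ∧ (∀ (S F : Fin 4 → ℤ → ℝ) (d : Fin 4 → Fin n → ℝ), (v (win S) ≤ 0 ∧ (∀ i k, S i k ^ 2 ≤ 2 * F i k) ∧ (∀ i k, 0 ≤ F i k) ∧ (∀ i k, (k < kLo ∨ kLo + n ≤ k) → F i k ≤ q k ^ 2 / 2) ∧ (∀ (i : Fin 4) (j : Fin n), F i (kLo + (j : ℕ)) ≤ Φ i j)) → 0 <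 g (win S) → (∀ (i : Fin 4) (j : Fin n), |d i j| ≤ η * (1 + 1 : ℝ) ^ ((2 : ℝ) * ((kLo + (j : ℕ) : ℤ) : ℝ)) * Real.sqrt (Φ i j)) → (fderiv ℝ v (win S)) (fun i j => vf S i (kLo + (j : ℕ)) + d i j) ≤ -γ) ∧ (∀ (S F : Fin 4 → ℤ → ℝ), (v (win S) ≤ 0 ∧ (∀ i k, S i k ^ 2 ≤ 2 * F i k) ∧ (∀ i k, 0 ≤ F i k) ∧ (∀ i k, (k < kLo ∨ kLo + n ≤ k) → F i k ≤ q k ^ 2 / 2) ∧ (∀ (i : Fin 4) (j : Fin n), F i (kLo + (j : ℕ)) ≤ Φ i j)) → ∀ (i : Fin 4) (k : ℤ), k < kLo → vf S i k * S i k ≤ ρ k * |S i k|) ∧ (∀ (S F : Fin 4 → ℤ → ℝ), (v (win S) ≤ 0 ∧ (∀ i k, S i k ^ 2 ≤ 2 * F i k) ∧ (∀ i k, 0 ≤ F i k) ∧ (∀ i k, (k < kLo ∨ kLo + n ≤ k) → F i k ≤ q k ^ 2 / 2) ∧ (∀ (i : Fin 4) (j : Fin n), F i (kLo + (j : ℕ))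 ≤ Φ i j)) → g (win S) ≤ 0 → (1 + 1 : ℝ) ^ (-θ) ≤ |S i₀ 1| ∧ v (win (fun i k => S i (1 + k) / |S i₀ 1|)) ≤ 0 ∧ 0 < g (win (fun i k => S i (1 + k) / |S i₀ 1|)) ∧ (∀ i k, k < kLo → F i (1 + k) / |S i₀ 1| ^ 2 ≤ r k ^ 2 / 2)) := by
  obtain ⟨R, θ, c, η, γ, i₀, α, X₀, n, kLo, v, g, r, q, ρ, env, Ψ, Mw, Φ, win, vf, Λ, δ, hR, hα, hX₀, hθ0,
    hθ, hc, hη, hγ, hkLo, hkn, hwin, hvf, hv, hg, hΨ, hprof, hup, hΦq, hdecay, hΦ, hM₁, hv0, hg0,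
    hproper, hfloor, hdec, hΛ, hΛ0, hbudget, htail, hgoal⟩ := hW
  refine ⟨R, θ, c, η, γ, i₀, α, X₀, n, kLo, v, g, r, q, ρ, env, Ψ, Mw, Φ, win, vf, hR, hα, hX₀, hθ0,
    hθ, hc, hη, hγ, hkLo, hkn, hwin, hvf, hv, hg, hΨ, hprof, hup, hΦq, hdecay, hΦ, hM₁, hv0, hg0,
    hproper, hfloor, ?_, htail, hgoal⟩
  intro S F d hreg hgS hd
  have hn : 0 < n := by omega
  have hδ : 0 ≤ δ := by
    refine le_trans ?_ (hbudget 0 ⟨0, hn⟩)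
    have h1 := (hΦ 0 ⟨0, hn⟩).1
    have h2 : 0 ≤ (1 + 1 : ℝ) ^ ((2 : ℝ) * ((kLo + ((⟨0, hn⟩ : Fin n) : ℕ) : ℤ) : ℝ)) :=
      (Real.rpow_pos_of_pos (by norm_num) _).le
    have h3 := Real.sqrt_nonneg (Φ 0 ⟨0, hn⟩)
    have h4 := hη.le
    positivity
  have h2 : (fderiv ℝ v (win S)) (fun i j => vf S i (kLo + (j : ℕ))) ≤ -(γ + δ) := hdec S F hreg hgS
  have habs := clm_add_le_of_opNorm_split (fderiv ℝ v (win S)) γ δ Λ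
    (fun i j => η * (1 + 1 : ℝ) ^ ((2 : ℝ) * ((kLo + (j : ℕ) : ℤ) : ℝ)) * Real.sqrt (Φ i j))
    (fun i j => vf S i (kLo + (j : ℕ))) d hδ hΛ0 h2 (hΛ _ hreg.1) hbudget hd
  have heq : (fun (i : Fin 4) (j : Fin n) => vf S i (kLo + (j : ℕ)) + d i j) =
      (fun (i : Fin 4) (j : Fin n) => vf S i (kLo + (j : ℕ))) + d := by
    funext i j
    rfl
  rw [heq]
  exact habs

/-- **Rung TL-M3 from a window certificate with a FREE margin split** (`WindowCertificateMarginSplit″ →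
Target`): compose `certificate₃_of_windowCertificateMarginSplit₃` with
`taoLadderRungThree_target_of_certificate₃`.
[cite: Tao2016AveragedNS, §6.4 Prop. 6.5 with §6.1–6.2; PrajnaRantzer2007 Thm 3.5 and §3.4] -/
theorem taoLadderRungThree_target_of_windowCertificateMarginSplit₃
    (hW : ∃ (R θ c η γ : ℝ) (i₀ : Fin 4) (α : Fin 4 → Fin 4 → Fin 4 → ℤ × ℤ × ℤ → ℝ) (X₀ : Fin 4 → ℝ) (n : ℕ) (kLo : ℤ) (v g : (Fin 4 → Fin n → ℝ) → ℝ) (r q ρ env Ψ : ℤ → ℝ) (Mw Φ : Fin 4 → Fin n → ℝ) (win : (Fin 4 → ℤ → ℝ) → (Fin 4 → Fin n → ℝ)) (vf : (Fin 4 → ℤ → ℝ) → (Fin 4 → ℤ → ℝ)) (Λ δ : ℝ), 1 ≤ R ∧ Literature.Analysis.FluidPDE.TaoCascade.InTableClass R α ∧ X₀ i₀ ≠ 0 ∧ 0 ≤ θ ∧ θ ≤ 1 / 2 ∧ 0 < c ∧ 0 < η ∧ 0 < γ ∧ kLo ≤ 0 ∧ (2 : ℤ) ≤ kLo + n ∧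 (∀ (S : Fin 4 → ℤ → ℝ) (i : Fin 4) (j : Fin n), win S i j = S i (kLo + (j : ℕ))) ∧ (∀ (S : Fin 4 → ℤ → ℝ) (i : Fin 4) (k : ℤ), vf S i k = Literature.Analysis.FluidPDE.TaoCascade.quadTerm 1 α (fun i' k' (_ : ℝ) => S i' k') i k 0) ∧ ContDiff ℝ 1 v ∧ Continuous g ∧ (∀ (L' : ℕ) (k : ℤ), Literature.Analysis.FluidPDE.TaoCascade.slackWeight 1 θ c env L' k ≤ Ψ k) ∧ (∀ k : ℤ, 0 ≤ r k ∧ r k < q k ∧ 0 ≤ ρ k ∧ r k + c * ρ k ≤ q k ∧ q k ^ 2 / 2 ≤ env k) ∧ (∀ k : ℤ, kLo + n ≤ k → (1 + 1 : ℝ) ^ ((5 : ℝ) * ((k - 1 : ℤ) : ℝ) / 2) * (∑ i₁ : Fin 4, ∑ i₂ : Fin 4, ∑ i₃ : Fin 4, |α i₁ i₂ i₃ (0, 0, 1)|) * q (k - 1) ^ 2 ≤ ρ k) ∧ (∀ (i : Fin 4) (j : Fin n), (j : ℕ) + 1 = n → 2 * Φ i j ≤ q (kLo + (j : ℕ)) ^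 2) ∧ (∀ k : ℤ, kLo + n ≤ k → q (k + 1) ≤ (1 + 1 : ℝ) ^ (-θ) * r k) ∧ (∀ (i : Fin 4) (j : Fin n), 0 ≤ Φ i j ∧ Φ i j ≤ env (kLo + (j : ℕ)) ∧ Mw i j ^ 2 / 2 + η * Ψ (kLo + (j : ℕ)) + η * (1 + 1 : ℝ) ^ ((2 : ℝ) * ((kLo + (j : ℕ) : ℤ) : ℝ)) * c * Φ i j < Φ i j) ∧ (∃ M₁ : ℝ, ∀ k : ℤ, kLo + n ≤ k → (1 + (1 + 1 : ℝ) ^ ((10 : ℝ) * (k : ℝ))) * q k ≤ M₁) ∧ v (win (Literature.Analysis.FluidPDE.TaoCascade.datumState i₀ X₀)) ≤ 0 ∧ 0 < g (win (Literature.Analysis.FluidPDE.TaoCascade.datumState i₀ X₀)) ∧ (∀ x : Fin 4 → Fin n → ℝ, v x ≤ 0 → ∀ i j, |x i j| ≤ Mw i j) ∧ (∀ x : Fin 4 → Fin n → ℝ, v x ≤ 0 → 0 < g x → -(γ * c) < v x) ∧ (∀ (S F : Fin 4 → ℤ → ℝ), (v (win S) ≤ 0 ∧ (∀ i k, S i k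 ^ 2 ≤ 2 * F i k) ∧ (∀ i k, 0 ≤ F i k) ∧ (∀ i k, (k < kLo ∨ kLo + n ≤ k) → F i k ≤ q k ^ 2 / 2) ∧ (∀ (i : Fin 4) (j : Fin n), F i (kLo + (j : ℕ)) ≤ Φ i j)) → 0 < g (win S) → (fderiv ℝ v (win S)) (fun i j => vf S i (kLo + (j : ℕ))) ≤ -(γ + δ)) ∧ (∀ x : Fin 4 → Fin n → ℝ, v x ≤ 0 → ‖fderiv ℝ v x‖ ≤ Λ) ∧ 0 ≤ Λ ∧ (∀ (i : Fin 4) (j : Fin n), Λ * (η * (1 + 1 : ℝ) ^ ((2 : ℝ) * ((kLo + (j : ℕ) : ℤ) : ℝ)) * Real.sqrt (Φ i j)) ≤ δ) ∧ (∀ (S F : Fin 4 → ℤ → ℝ), (v (win S) ≤ 0 ∧ (∀ i k, S i k ^ 2 ≤ 2 * F i k) ∧ (∀ i k, 0 ≤ F i k) ∧ (∀ i k, (k < kLo ∨ kLo + n ≤ k) → F i k ≤ q k ^ 2 / 2) ∧ (∀ (i : Fin 4) (j : Fin n), F i (kLo + (j : ℕ)) ≤ Φ i j)) → ∀ (i :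 Fin 4) (k : ℤ), k < kLo → vf S i k * S i k ≤ ρ k * |S i k|) ∧ (∀ (S F : Fin 4 → ℤ → ℝ), (v (win S) ≤ 0 ∧ (∀ i k, S i k ^ 2 ≤ 2 * F i k) ∧ (∀ i k, 0 ≤ F i k) ∧ (∀ i k, (k < kLo ∨ kLo + n ≤ k) → F i k ≤ q k ^ 2 / 2) ∧ (∀ (i : Fin 4) (j : Fin n), F i (kLo + (j : ℕ)) ≤ Φ i j)) → g (win S) ≤ 0 → (1 + 1 : ℝ) ^ (-θ) ≤ |S i₀ 1| ∧ v (win (fun i k => S i (1 + k) / |S i₀ 1|)) ≤ 0 ∧ 0 < g (win (fun i k => S i (1 + k) / |S i₀ 1|)) ∧ (∀ i k, k < kLo → F i (1 + k) / |S i₀ 1| ^ 2 ≤ r k ^ 2 / 2))) :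
    Summit.NavierStokesRegularity.NavierStokesRegularity.Theses.TaoLadderRungThree.Target :=
  taoLadderRungThree_target_of_certificate₃ (certificate₃_of_windowCertificateMarginSplit₃ hW)

end Summit.NavierStokesRegularity.NavierStokesRegularity.Theorems

end
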